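import Summits.AtomisticToContinuum.FouriersLaw.Theorems.EmbeddedDrudeMourreAbelThermodynamicLimitFixedHorizonMatching
import Summits.AtomisticToContinuum.FouriersLaw.Theorems.EmbeddedDrudeMourreAbelThermodynamicLimitCentralBondCurrentSecondMoments
import HarnessLib

/-!
# `stub_fixedHorizonMatching` of line `loomis-compact-horizon-witness`, part 2: the window leaves
(crux `EmbeddedDrudeMourre.AbelThermodynamicLimit`, item stmt-AtomisticToContinuum-12596;
`--supports` helper file for the registered stub S4 `stub_fixedHorizonMatching`, closes nothing)

Part 1 (`…FixedHorizonMatching`) reduced S4 to (L1) fixed-time matching `S_N(t) → C_T(t)` of the anchored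
sum `S_N(t) = Σ_k ⟨j_{c_N}(0) j_k(t)⟩_{N,T}` and (L2) its `N`-uniform boundedness on compact time
intervals. This file (sorry-free) splits both along the window `|k - c_N| ≤ R`:

* §4 (L2) from (C) `N`-UNIFORM ANCHORED TAILS (`Σ_{|k-c_N|>R} |⟨j_{c_N}(0) j_k(t)⟩_{N,T}| ≤ ε` for
  `N ≥ N₀`, `t ∈ [0, τ]`) and (A₂) CENTRAL SECOND MOMENTS (`⟨j_k²⟩_{N,T} ≤ M` on every central window);
* §5 (L1) from (B₀) PER-OFFSET FIXED-TIME MATCHING (`⟨j_{c_N}(0) j_{c_N+x}(t)⟩_{N,T} → ∫ j_0 (j_x ∘ φ_t) dμT`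
  for every offset `x` and `t > 0`), (C), and the absolute convergence of the witness's correlation sum;
* §4 and §5 are the **registered sub-goals `stub_anchoredSumBoundedOfTailsOfMoments`,
  `stub_fixedTimeMatchingOfOffsetsOfTails`**; §6 is the **registered sub-goal
  `stub_fixedHorizonMatchingOfDynamicalLeaves`**: S4's hypotheses + (C) + (B₀) ⟹ S4's conclusion, the
  static leaf (A₂) being PROVED in part 3 (`…CentralBondCurrentSecondMoments`, one-site domination of
  the even position moments). So S4 follows BY NAME from the two DYNAMICAL leaves (registered as
  `stub_anchoredCorrelationTails`, `stub_fixedTimeOffsetMatching`): (C) is the light cone of the open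
  chain at FIXED time (no static clustering needed: `j_{c_N}` has zero conditional mean given the
  positions), (B₀) the two-dynamics coupling on the central window + convergence of the central window
  laws of `gibbsMeasure N T` to the unique regular DLR state (the only leaf using the witness and
  `RegUniq_T`). Neither is in the tree.
-/

noncomputable section

open MeasureTheory ProbabilityTheory Filter Topology Set Function
open scoped NNReal ENNReal

namespace Summit.AtomisticToContinuum.FouriersLaw.Theorems.AbelThermodynamicLimit.LoomisCompactHorizonWitness

open Literature.MathematicalPhysics.KineticTheory.HeatConduction
open Literature.MathematicalPhysics.KineticTheory OscillatorChain
open Summit.AtomisticToContinuum.FouriersLaw.Theorems.SubdiffusiveBondHeat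
open Summit.AtomisticToContinuum.FouriersLaw.Theorems.LightConeBondHeat

/-! ## §4 (L2) from `N`-uniform anchored tails and central second moments -/

/-- **Registered sub-goal `stub_anchoredSumBoundedOfTailsOfMoments` — (L2) from (C) and (A₂).**
`N`-uniform smallness of the anchored tails on `[0, τ]` (C) and an `N`-uniform bound on the second
moments `⟨j_k²⟩_{N,T}` of the bond currents in every central window (A₂) give `N`-uniform boundedness of the anchored sum `S_N(t) = Σ_k ⟨j_{c_N}(0) j_k(t)⟩_{N,T}` on
`[0, τ]`: window terms are bounded by `½(⟨j_c²⟩ + ⟨j_k²⟩)` (§1), there are at most `2R + 1` of them,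
and the tail is `≤ 1`. [folklore] -/
theorem stub_anchoredSumBoundedOfTailsOfMoments :
    ∀ ω₂ lam β γ : ℝ, 0 < ω₂ → 0 < lam → 0 < β → 0 < γ → ∀ T : ℝ, 0 < T →
      (∀ R : ℕ, ∃ M : ℝ, ∃ N₀ : ℕ, ∀ N : ℕ, N₀ ≤ N → ∀ k : Fin N,
        (N - 1) / 2 ≤ k.val + R → k.val ≤ (N - 1) / 2 + R →
          ∫ z, ((Literature.MathematicalPhysics.KineticTheory.HeatConduction.pinnedChain
                  ω₂ lam β γ).bondCurrent N k z) ^ 2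
            ∂((Literature.MathematicalPhysics.KineticTheory.HeatConduction.pinnedChain
                  ω₂ lam β γ).gibbsMeasure N T) ≤ M) →
      (∀ τ : ℝ, 0 < τ → ∀ ε : ℝ, 0 < ε → ∃ R : ℕ, ∃ N₀ : ℕ, ∀ N : ℕ, N₀ ≤ N → ∀ hN : 2 ≤ N,
        ∀ t ∈ Set.Icc (0 : ℝ) τ,
          (∑ k : Fin N, if (N - 1) / 2 ≤ k.val + R ∧ k.val ≤ (N - 1) / 2 + R then (0 : ℝ) else
            |∫ z, (Literature.MathematicalPhysics.KineticTheory.HeatConduction.pinnedChain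
                      ω₂ lam β γ).bondCurrent N ⟨(N - 1) / 2, by omega⟩ z *
                (∫ y, (Literature.MathematicalPhysics.KineticTheory.HeatConduction.pinnedChain
                      ω₂ lam β γ).bondCurrent N k y
                  ∂((Literature.MathematicalPhysics.KineticTheory.HeatConduction.pinnedChain
                      ω₂ lam β γ).transitionKernel N T T t.toNNReal z))
              ∂((Literature.MathematicalPhysics.KineticTheory.HeatConduction.pinnedChain
                      ω₂ lam β γ).gibbsMeasure N T)|) ≤ ε) →
      ∀ τ : ℝ, 0 < τ → ∃ M : ℝ, ∃ N₀ : ℕ, ∀ N : ℕ, N₀ ≤ N → ∀ hN : 2 ≤ N,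
        ∀ t ∈ Set.Icc (0 : ℝ) τ,
          |∑ k : Fin N,
            ∫ z, (Literature.MathematicalPhysics.KineticTheory.HeatConduction.pinnedChain
                    ω₂ lam β γ).bondCurrent N ⟨(N - 1) / 2, by omega⟩ z *
              (∫ y, (Literature.MathematicalPhysics.KineticTheory.HeatConduction.pinnedChain
                    ω₂ lam β γ).bondCurrent N k y
                ∂((Literature.MathematicalPhysics.KineticTheory.HeatConduction.pinnedChain
                    ω₂ lam β γ).transitionKernel N T T t.toNNReal z))
            ∂((Literature.MathematicalPhysics.KineticTheory.HeatConduction.pinnedChain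
                    ω₂ lam β γ).gibbsMeasure N T)| ≤ M := by
  intro ω₂ lam β γ hω hl hβ hγ T hT hA hC τ hτ
  obtain ⟨R, N₁, hR⟩ := hC τ hτ 1 one_pos
  obtain ⟨M, N₂, hM⟩ := hA R
  set M' : ℝ := max M 0 with hM'
  have hM'0 : 0 ≤ M' := le_max_right _ _
  refine ⟨(2 * R + 1) * M' + 1, max N₁ N₂, fun N hN h2 t ht => ?_⟩
  have hN₁ : N₁ ≤ N := le_trans (le_max_left _ _) hN
  have hN₂ : N₂ ≤ N := le_trans (le_max_right _ _) hN
  have hN0 : 0 < N := by omega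
  set c : Fin N := ⟨(N - 1) / 2, by omega⟩ with hc
  -- window terms: `|⟨j_c(0) j_k(t)⟩| ≤ ½(⟨j_c²⟩ + ⟨j_k²⟩) ≤ M'`
  have hwin : ∀ k : Fin N, (N - 1) / 2 ≤ k.val + R ∧ k.val ≤ (N - 1) / 2 + R →
      |(∫ z, (pinnedChain ω₂ lam β γ).bondCurrent N c z *
          (∫ y, (pinnedChain ω₂ lam β γ).bondCurrent N k y
            ∂((pinnedChain ω₂ lam β γ).transitionKernel N T T t.toNNReal z))
          ∂((pinnedChain ω₂ lam β γ).gibbsMeasure N T))| ≤ M' := by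
    intro k hk
    have h1 := pinnedChain_abs_pairCorr_le hω hl.le hβ hγ hN0 hT c k t
    have h2 : ∫ z, ((pinnedChain ω₂ lam β γ).bondCurrent N c z) ^ 2
        ∂((pinnedChain ω₂ lam β γ).gibbsMeasure N T) ≤ M' :=
      (hM N hN₂ c (by simp [hc]) (by simp [hc])).trans (le_max_left _ _)
    have h3 : ∫ z, ((pinnedChain ω₂ lam β γ).bondCurrent N k z) ^ 2
        ∂((pinnedChain ω₂ lam β γ).gibbsMeasure N T) ≤ M' :=
      (hM N hN₂ k hk.1 hk.2).trans (le_max_left _ _)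
    linarith
  have htail := hR N hN₁ h2 t ht
  have hsplit := abs_sum_le_abs_window_add_tail
    (fun k : Fin N => (N - 1) / 2 ≤ k.val + R ∧ k.val ≤ (N - 1) / 2 + R)
    (fun k => (∫ z, (pinnedChain ω₂ lam β γ).bondCurrent N c z *
        (∫ y, (pinnedChain ω₂ lam β γ).bondCurrent N k y
          ∂((pinnedChain ω₂ lam β γ).transitionKernel N T T t.toNNReal z))
        ∂((pinnedChain ω₂ lam β γ).gibbsMeasure N T)))
  have hwsum : |∑ k : Fin N, if (N - 1) / 2 ≤ k.val + R ∧ k.val ≤ (N - 1) / 2 + R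
      then (∫ z, (pinnedChain ω₂ lam β γ).bondCurrent N c z *
          (∫ y, (pinnedChain ω₂ lam β γ).bondCurrent N k y
            ∂((pinnedChain ω₂ lam β γ).transitionKernel N T T t.toNNReal z))
          ∂((pinnedChain ω₂ lam β γ).gibbsMeasure N T)) else 0| ≤ (2 * R + 1) * M' := by
    refine (Finset.abs_sum_le_sum_abs _ _).trans ?_
    refine (Finset.sum_le_sum fun k _ => ?_).trans (sum_ite_window_const_le (N := N) (R := R) hM'0)
    split_ifs with hk
    · exact hwin k hk
    · simp
  linarith

/-! ## §5 (L1) from per-offset fixed-time matching, `N`-uniform anchored tails and absolute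
convergence of the witness's correlation sum -/

/-- **Registered sub-goal `stub_fixedTimeMatchingOfOffsetsOfTails` — (L1) from (B₀) and (C).** For a
dynamics `D` and state `μT` with absolutely convergent summed current correlations, per-offset
fixed-time matching (B₀)
`⟨j_{c_N}(0) j_{c_N + x}(t)⟩_{N,T} → ∫ j_0 · (j_x ∘ φ_t) dμT` (every offset `x`, every `t > 0`) and
`N`-uniform smallness of the anchored tails (C) give fixed-time matching of the anchored sum:
`S_N(t) → C_T(t) = Σ_x ∫ j_0 · (j_x ∘ φ_t) dμT` for every `t > 0` (`ε/3`: window by (B₀) after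
reindexing by offsets, open-chain tail by (C), witness tail by absolute convergence). [folklore] -/
theorem stub_fixedTimeMatchingOfOffsetsOfTails :
    ∀ (ω₂ lam β γ T : ℝ)
      (μT : MeasureTheory.Measure
            Literature.MathematicalPhysics.KineticTheory.HeatConduction.ChainConfig)
      (D : Literature.MathematicalPhysics.KineticTheory.HeatConduction.InfiniteChainDynamics
          (Literature.MathematicalPhysics.KineticTheory.HeatConduction.pinnedChain ω₂ lam β γ)),
      (∀ t : ℝ, D.HasAbsConvergentCorrelation μT t) →
      (∀ (x : ℤ) (t : ℝ), 0 < t →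
        Filter.Tendsto (fun N : ℕ =>
            if hN : 2 * x.natAbs + 2 ≤ N then
              ∫ z, (Literature.MathematicalPhysics.KineticTheory.HeatConduction.pinnedChain
                      ω₂ lam β γ).bondCurrent N ⟨(N - 1) / 2, by omega⟩ z *
                (∫ y, (Literature.MathematicalPhysics.KineticTheory.HeatConduction.pinnedChain
                      ω₂ lam β γ).bondCurrent N ⟨((((N - 1) / 2 : ℕ) : ℤ) + x).toNat, by omega⟩ y
                  ∂((Literature.MathematicalPhysics.KineticTheory.HeatConduction.pinnedChain
                      ω₂ lam β γ).transitionKernel N T T t.toNNReal z))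
                ∂((Literature.MathematicalPhysics.KineticTheory.HeatConduction.pinnedChain
                      ω₂ lam β γ).gibbsMeasure N T)
            else 0)
          Filter.atTop
          (nhds (∫ σ, (Literature.MathematicalPhysics.KineticTheory.HeatConduction.pinnedChain
                    ω₂ lam β γ).bondCurrentZ σ 0 *
            (Literature.MathematicalPhysics.KineticTheory.HeatConduction.pinnedChain
                    ω₂ lam β γ).bondCurrentZ (D.flow t σ) x ∂μT))) →
      (∀ τ : ℝ, 0 < τ → ∀ ε : ℝ, 0 < ε → ∃ R : ℕ, ∃ N₀ : ℕ, ∀ N : ℕ, N₀ ≤ N → ∀ hN : 2 ≤ N,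
        ∀ t ∈ Set.Icc (0 : ℝ) τ,
          (∑ k : Fin N, if (N - 1) / 2 ≤ k.val + R ∧ k.val ≤ (N - 1) / 2 + R then (0 : ℝ) else
            |∫ z, (Literature.MathematicalPhysics.KineticTheory.HeatConduction.pinnedChain
                      ω₂ lam β γ).bondCurrent N ⟨(N - 1) / 2, by omega⟩ z *
                (∫ y, (Literature.MathematicalPhysics.KineticTheory.HeatConduction.pinnedChain
                      ω₂ lam β γ).bondCurrent N k y
                  ∂((Literature.MathematicalPhysics.KineticTheory.HeatConduction.pinnedChain
                      ω₂ lam β γ).transitionKernel N T T t.toNNReal z))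
              ∂((Literature.MathematicalPhysics.KineticTheory.HeatConduction.pinnedChain
                      ω₂ lam β γ).gibbsMeasure N T)|) ≤ ε) →
      ∀ t : ℝ, 0 < t →
        Filter.Tendsto (fun N : ℕ =>
            if hN : 2 ≤ N then
              ∑ k : Fin N,
                ∫ z, (Literature.MathematicalPhysics.KineticTheory.HeatConduction.pinnedChain
                        ω₂ lam β γ).bondCurrent N ⟨(N - 1) / 2, by omega⟩ z *
                  (∫ y, (Literature.MathematicalPhysics.KineticTheory.HeatConduction.pinnedChain
                        ω₂ lam β γ).bondCurrent N k y
                    ∂((Literature.MathematicalPhysics.KineticTheory.HeatConduction.pinnedChain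
                        ω₂ lam β γ).transitionKernel N T T t.toNNReal z))
                ∂((Literature.MathematicalPhysics.KineticTheory.HeatConduction.pinnedChain
                        ω₂ lam β γ).gibbsMeasure N T)
            else 0)
          Filter.atTop (nhds (D.currentCorrelation μT t)) := by
  intro ω₂ lam β γ T μT D hAC hB hC t ht
  -- the witness side: `Σ_{|x| ≤ n} c_x(t) → C_T(t)`
  set cx : ℤ → ℝ := fun x => ∫ σ, (pinnedChain ω₂ lam β γ).bondCurrentZ σ 0 *
    (pinnedChain ω₂ lam β γ).bondCurrentZ (D.flow t σ) x ∂μT with hcx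
  have hsum : Summable cx := (hAC t).2.of_abs
  have hCT : D.currentCorrelation μT t = ∑' x, cx x := rfl
  have hlim : Tendsto (fun n : ℕ => ∑ x ∈ Finset.Icc (-(n : ℤ)) n, cx x) atTop
      (𝓝 (D.currentCorrelation μT t)) := by
    rw [hCT]
    have h := hsum.hasSum
    rw [HasSum, SummationFilter.unconditional_filter] at h
    exact h.comp Finset.tendsto_Icc_neg
  rw [Metric.tendsto_atTop]
  intro ε hε
  have hε3 : 0 < ε / 3 := by positivity
  obtain ⟨R₁, hR₁⟩ := (Metric.tendsto_atTop.1 hlim) (ε / 3) hε3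
  obtain ⟨R₂, N₁, hR₂⟩ := hC t ht (ε / 3) hε3
  set R : ℕ := max R₁ R₂ with hRdef
  -- the window converges offset by offset
  have hwin : Tendsto (fun N : ℕ => ∑ x ∈ Finset.Icc (-(R : ℤ)) R,
      if hN : 2 * x.natAbs + 2 ≤ N then
        (∫ z, (pinnedChain ω₂ lam β γ).bondCurrent N ⟨(N - 1) / 2, by omega⟩ z *
            (∫ y, (pinnedChain ω₂ lam β γ).bondCurrent N ⟨((((N - 1) / 2 : ℕ) : ℤ) + x).toNat, by omega⟩ y
              ∂((pinnedChain ω₂ lam β γ).transitionKernel N T T t.toNNReal z))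
            ∂((pinnedChain ω₂ lam β γ).gibbsMeasure N T))
      else 0) atTop (𝓝 (∑ x ∈ Finset.Icc (-(R : ℤ)) R, cx x)) :=
    tendsto_finsetSum _ fun x _ => hB x t ht
  obtain ⟨N₂, hN₂⟩ := (Metric.tendsto_atTop.1 hwin) (ε / 3) hε3
  refine ⟨max (max N₁ N₂) (2 * R + 2), fun N hN => ?_⟩
  have hN₁ : N₁ ≤ N := le_trans (le_trans (le_max_left _ _) (le_max_left _ _)) hN
  have hN₂' : N₂ ≤ N := le_trans (le_trans (le_max_right _ _) (le_max_left _ _)) hN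
  have hNR : 2 * R + 2 ≤ N := le_trans (le_max_right _ _) hN
  have h2 : 2 ≤ N := by omega
  rw [dif_pos h2, Real.dist_eq]
  set c : Fin N := ⟨(N - 1) / 2, by omega⟩ with hc
  -- three pieces
  have hA := hR₁ R (le_max_left _ _)
  rw [Real.dist_eq] at hA
  have hBw := hN₂ N hN₂'
  rw [Real.dist_eq, ← sum_ite_window_eq_sum_Icc hNR
    (fun k => (∫ z, (pinnedChain ω₂ lam β γ).bondCurrent N c z *
      (∫ y, (pinnedChain ω₂ lam β γ).bondCurrent N k y
        ∂((pinnedChain ω₂ lam β γ).transitionKernel N T T t.toNNReal z))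
      ∂((pinnedChain ω₂ lam β γ).gibbsMeasure N T)))] at hBw
  have hCt : (∑ k : Fin N, if (N - 1) / 2 ≤ k.val + R ∧ k.val ≤ (N - 1) / 2 + R then (0 : ℝ)
      else |(∫ z, (pinnedChain ω₂ lam β γ).bondCurrent N c z *
          (∫ y, (pinnedChain ω₂ lam β γ).bondCurrent N k y
            ∂((pinnedChain ω₂ lam β γ).transitionKernel N T T t.toNNReal z))
          ∂((pinnedChain ω₂ lam β γ).gibbsMeasure N T))|) ≤ ε / 3 :=
    (tail_antitone (le_max_right R₁ R₂) _).trans (hR₂ N hN₁ h2 t ⟨ht.le, le_rfl⟩)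
  have hsplit : ∑ k : Fin N, (∫ z, (pinnedChain ω₂ lam β γ).bondCurrent N c z *
      (∫ y, (pinnedChain ω₂ lam β γ).bondCurrent N k y
        ∂((pinnedChain ω₂ lam β γ).transitionKernel N T T t.toNNReal z))
      ∂((pinnedChain ω₂ lam β γ).gibbsMeasure N T)) =
      (∑ k : Fin N, if (N - 1) / 2 ≤ k.val + R ∧ k.val ≤ (N - 1) / 2 + R then
          (∫ z, (pinnedChain ω₂ lam β γ).bondCurrent N c z *
          (∫ y, (pinnedChain ω₂ lam β γ).bondCurrent N k y
            ∂((pinnedChain ω₂ lam β γ).transitionKernel N T T t.toNNReal z))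
          ∂((pinnedChain ω₂ lam β γ).gibbsMeasure N T)) else 0) +
        ∑ k : Fin N, if (N - 1) / 2 ≤ k.val + R ∧ k.val ≤ (N - 1) / 2 + R then 0 else
          (∫ z, (pinnedChain ω₂ lam β γ).bondCurrent N c z *
            (∫ y, (pinnedChain ω₂ lam β γ).bondCurrent N k y
              ∂((pinnedChain ω₂ lam β γ).transitionKernel N T T t.toNNReal z))
            ∂((pinnedChain ω₂ lam β γ).gibbsMeasure N T)) := by
    rw [← Finset.sum_add_distrib]
    refine Finset.sum_congr rfl fun k _ => ?_
    split_ifs <;> simp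
  have htail : |∑ k : Fin N, if (N - 1) / 2 ≤ k.val + R ∧ k.val ≤ (N - 1) / 2 + R then (0 : ℝ)
      else (∫ z, (pinnedChain ω₂ lam β γ).bondCurrent N c z *
          (∫ y, (pinnedChain ω₂ lam β γ).bondCurrent N k y
            ∂((pinnedChain ω₂ lam β γ).transitionKernel N T T t.toNNReal z))
          ∂((pinnedChain ω₂ lam β γ).gibbsMeasure N T))| ≤ ε / 3 := by
    refine (Finset.abs_sum_le_sum_abs _ _).trans (le_trans (le_of_eq ?_) hCt)
    refine Finset.sum_congr rfl fun k _ => ?_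
    split_ifs <;> simp
  rw [hsplit]
  set W : ℝ := (∑ k : Fin N, if (N - 1) / 2 ≤ k.val + R ∧ k.val ≤ (N - 1) / 2 + R
    then (∫ z, (pinnedChain ω₂ lam β γ).bondCurrent N c z *
        (∫ y, (pinnedChain ω₂ lam β γ).bondCurrent N k y
          ∂((pinnedChain ω₂ lam β γ).transitionKernel N T T t.toNNReal z))
        ∂((pinnedChain ω₂ lam β γ).gibbsMeasure N T)) else 0) with hW
  set Tl : ℝ := (∑ k : Fin N, if (N - 1) / 2 ≤ k.val + R ∧ k.val ≤ (N - 1) / 2 + R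
    then 0 else (∫ z, (pinnedChain ω₂ lam β γ).bondCurrent N c z *
        (∫ y, (pinnedChain ω₂ lam β γ).bondCurrent N k y
          ∂((pinnedChain ω₂ lam β γ).transitionKernel N T T t.toNNReal z))
        ∂((pinnedChain ω₂ lam β γ).gibbsMeasure N T))) with hTl
  set s : ℝ := ∑ x ∈ Finset.Icc (-(R : ℤ)) R, cx x with hs
  have key : W + Tl - D.currentCorrelation μT t = (W - s) + (s - D.currentCorrelation μT t) + Tl := by
    ring
  rw [key]
  exact lt_of_le_of_lt (abs_add_three _ _ _) (by linarith [hBw, hA, htail])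


/-! ## §6 S4 from the two dynamical leaves -/

/-- **Registered sub-goal `stub_fixedHorizonMatchingOfDynamicalLeaves` — S4 from the two DYNAMICAL
leaves.** The hypotheses of the registered stub S4 `stub_fixedHorizonMatching`, plus
(C) `N`-UNIFORM ANCHORED TAILS — for every `τ > 0`, `ε > 0` there are `R`, `N₀` with
`Σ_{|k - c_N| > R} |⟨j_{c_N}(0) j_k(t)⟩_{N,T}| ≤ ε` for all `N ≥ N₀`, `t ∈ [0, τ]` (light cone of the open
chain at fixed time; only the chain parameters and `T` enter; registered leaf
`stub_anchoredCorrelationTails`), and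
(B₀) PER-OFFSET FIXED-TIME MATCHING — for every offset `x ∈ ℤ` and `t > 0`,
`⟨j_{c_N}(0) j_{c_N + x}(t)⟩_{N,T} → ∫ j_0 · (j_x ∘ φ_t) dμT` (two-dynamics coupling on the central
window + convergence of the central window laws of `gibbsMeasure N T` to the unique regular DLR
state `μT`; the only leaf where the witness and `RegUniq_T` enter; registered leaf
`stub_fixedTimeOffsetMatching`),
imply S4's conclusion for every `τ > 0`: the static leaf (A₂) is PROVED (part 3,
`stub_centralBondCurrentSecondMoments`), (C) + (A₂) give (L2) and (B₀) + (C) + absolute convergence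
give (L1) (§4, §5), then part 1 (`stub_fixedHorizonMatchingOfFixedTime`). So S4 follows BY NAME from
the two dynamical leaves. [folklore] -/
theorem stub_fixedHorizonMatchingOfDynamicalLeaves :
    ∀ ω₂ lam β γ : ℝ, 0 < ω₂ → 0 < lam → 0 < β → 0 < γ → ∀ T : ℝ, 0 < T →
      (∀ τ : ℝ, 0 < τ → ∀ ε : ℝ, 0 < ε → ∃ R : ℕ, ∃ N₀ : ℕ, ∀ N : ℕ, N₀ ≤ N → ∀ hN : 2 ≤ N,
        ∀ t ∈ Set.Icc (0 : ℝ) τ,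
          (∑ k : Fin N, if (N - 1) / 2 ≤ k.val + R ∧ k.val ≤ (N - 1) / 2 + R then (0 : ℝ) else
            |∫ z, (Literature.MathematicalPhysics.KineticTheory.HeatConduction.pinnedChain
                      ω₂ lam β γ).bondCurrent N ⟨(N - 1) / 2, by omega⟩ z *
                (∫ y, (Literature.MathematicalPhysics.KineticTheory.HeatConduction.pinnedChain
                      ω₂ lam β γ).bondCurrent N k y
                  ∂((Literature.MathematicalPhysics.KineticTheory.HeatConduction.pinnedChain
                      ω₂ lam β γ).transitionKernel N T T t.toNNReal z))
              ∂((Literature.MathematicalPhysics.KineticTheory.HeatConduction.pinnedChain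
                      ω₂ lam β γ).gibbsMeasure N T)|) ≤ ε) →
      (∀ μ₁ μ₂ : MeasureTheory.Measure
            Literature.MathematicalPhysics.KineticTheory.HeatConduction.ChainConfig,
          (Literature.MathematicalPhysics.KineticTheory.HeatConduction.pinnedChain
                ω₂ lam β γ).IsChainGibbsMeasure T μ₁ →
          Literature.MathematicalPhysics.KineticTheory.HeatConduction.IsShiftInvariant μ₁ →
          (Literature.MathematicalPhysics.KineticTheory.HeatConduction.pinnedChain
                ω₂ lam β γ).HasSuperstabilityEstimate μ₁ →
          (Literature.MathematicalPhysics.KineticTheory.HeatConduction.pinnedChain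
                ω₂ lam β γ).IsChainGibbsMeasure T μ₂ →
          Literature.MathematicalPhysics.KineticTheory.HeatConduction.IsShiftInvariant μ₂ →
          (Literature.MathematicalPhysics.KineticTheory.HeatConduction.pinnedChain
                ω₂ lam β γ).HasSuperstabilityEstimate μ₂ → μ₁ = μ₂) →
      ∀ (μT : MeasureTheory.Measure
            Literature.MathematicalPhysics.KineticTheory.HeatConduction.ChainConfig)
        (D : Literature.MathematicalPhysics.KineticTheory.HeatConduction.InfiniteChainDynamics
          (Literature.MathematicalPhysics.KineticTheory.HeatConduction.pinnedChain ω₂ lam β γ)),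
        (Literature.MathematicalPhysics.KineticTheory.HeatConduction.pinnedChain
            ω₂ lam β γ).IsChainGibbsMeasure T μT →
        Literature.MathematicalPhysics.KineticTheory.HeatConduction.IsShiftInvariant μT →
        (Literature.MathematicalPhysics.KineticTheory.HeatConduction.pinnedChain
            ω₂ lam β γ).HasSuperstabilityEstimate μT →
        D.carrier ⊆ (Literature.MathematicalPhysics.KineticTheory.HeatConduction.pinnedChain
            ω₂ lam β γ).bmGood →
        D.PreservesMeasure μT →
        (∀ t : ℝ, D.HasAbsConvergentCorrelation μT t) →
        (∀ (x : ℤ) (t : ℝ), 0 < t →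
          Filter.Tendsto (fun N : ℕ =>
              if hN : 2 * x.natAbs + 2 ≤ N then
                ∫ z, (Literature.MathematicalPhysics.KineticTheory.HeatConduction.pinnedChain
                        ω₂ lam β γ).bondCurrent N ⟨(N - 1) / 2, by omega⟩ z *
                  (∫ y, (Literature.MathematicalPhysics.KineticTheory.HeatConduction.pinnedChain
                        ω₂ lam β γ).bondCurrent N ⟨((((N - 1) / 2 : ℕ) : ℤ) + x).toNat, by omega⟩ y
                    ∂((Literature.MathematicalPhysics.KineticTheory.HeatConduction.pinnedChain
                        ω₂ lam β γ).transitionKernel N T T t.toNNReal z))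
                  ∂((Literature.MathematicalPhysics.KineticTheory.HeatConduction.pinnedChain
                        ω₂ lam β γ).gibbsMeasure N T)
              else 0)
            Filter.atTop
            (nhds (∫ σ, (Literature.MathematicalPhysics.KineticTheory.HeatConduction.pinnedChain
                      ω₂ lam β γ).bondCurrentZ σ 0 *
              (Literature.MathematicalPhysics.KineticTheory.HeatConduction.pinnedChain
                      ω₂ lam β γ).bondCurrentZ (D.flow t σ) x ∂μT))) →
        ∀ τ : ℝ, 0 < τ →
          Filter.Tendsto (fun N : ℕ =>
              if hN : 2 ≤ N then
                ∑ k : Fin N, ∫ t in Set.Ioc (0 : ℝ) τ, (1 - t / τ) ^ 2 *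
                  ∫ z, (Literature.MathematicalPhysics.KineticTheory.HeatConduction.pinnedChain
                          ω₂ lam β γ).bondCurrent N ⟨(N - 1) / 2, by omega⟩ z *
                    (∫ y, (Literature.MathematicalPhysics.KineticTheory.HeatConduction.pinnedChain
                          ω₂ lam β γ).bondCurrent N k y
                      ∂((Literature.MathematicalPhysics.KineticTheory.HeatConduction.pinnedChain
                          ω₂ lam β γ).transitionKernel N T T t.toNNReal z))
                  ∂((Literature.MathematicalPhysics.KineticTheory.HeatConduction.pinnedChain
                          ω₂ lam β γ).gibbsMeasure N T)
              else 0)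
            Filter.atTop
            (nhds (∫ t in Set.Ioc (0 : ℝ) τ, (1 - t / τ) ^ 2 * D.currentCorrelation μT t)) := by
  intro ω₂ lam β γ hω hl hβ hγ T hT hC hU μT D hG hS hss hcar hPres hAC hB τ hτ
  exact stub_fixedHorizonMatchingOfFixedTime ω₂ lam β γ hω hl hβ hγ T hT hU μT D hG hS hss hcar hPres hAC
    (stub_anchoredSumBoundedOfTailsOfMoments ω₂ lam β γ hω hl hβ hγ T hT
      (stub_centralBondCurrentSecondMoments ω₂ lam β γ hω hl hβ hγ T hT) hC)
    (stub_fixedTimeMatchingOfOffsetsOfTails ω₂ lam β γ T μT D hAC hB hC) τ hτ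

end Summit.AtomisticToContinuum.FouriersLaw.Theorems.AbelThermodynamicLimit.LoomisCompactHorizonWitness

end
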